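/-
Copyright (c) 2026 the pub-hodgecm-mathlib formalisation cell (harness21).  Prover seat hodgecm-mathlib-F0P3a-p04 (g23), 2026-09-02 (line LH7, O8a∕O8b roads:
the CM discharges of the weak-approximation hypothesis `hWA` of ★ `AutomorphicScalarSubgroup` §3).  PROOF module: THEOREMS ONLY (no definition, no named
fact, no instance, no notation, no `sorry`).
-/
import Literature.NumberTheory.Automorphic.UnitaryGroupFiniteAdelicDenseOrbitCM   -- ★ p850646: `denseRange_archPart_toAdelic_cm`, `antidiagOne_map_complexConj_transpose` (+ ★ `LocalUnitaryGroupCongr`, ★ `AdelicUnitaryGroupDatum`)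
import Literature.NumberTheory.Automorphic.AutomorphicScalarSubgroup              -- ★ p850645: `exists_eq_ofChar_of_forall_finAdelicToAdelic_apply_eq_smul (hWA)`, `…_of_forall_apply_eq_self_of_commutator_mem (hWA)`
import HarnessLib

/-!
# A discrete automorphic representation of `U(H)` over a CM field on which `U(H)(𝔸_{L⁺,f})` acts by scalars (or with trivial derived action)
# is the line of an automorphic character — the weak-approximation hypothesis of `AutomorphicScalarSubgroup` §3 DISCHARGED

Topic `NumberTheory/Automorphic`; namespace `Literature.NumberTheory.Automorphic.UnitaryGroup`.  THEOREMS ONLY.  Sequel of ★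
`UnitaryGroupFiniteAdelicDenseOrbitCM` (same seat), which discharged `hWA : DenseRange fun γ => archPart … (toAdelic γ)` for a CM field `L` and a
non-degenerate hermitian `H` (★ `denseRange_archPart_toAdelic_cm`, from ★ `UnitaryGroupRealApproximation :: denseRange_rationalToArch_cm`,
[PlatonovRapinchuk1994] §7.1 Thm. 7.7) in the `L²` consequences of ★ `UnitaryGroupFiniteAdelicDenseOrbit`.  ★ p850645 `AutomorphicScalarSubgroup` §3
then proved two more consequences UNDER `hWA` — scalars NOT assumed automorphic (Schur + ★ `AutomorphicEigencharacter`):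
* `exists_eq_ofChar_of_forall_finAdelicToAdelic_apply_eq_smul (hWA) (P) (hP : R(1,b) v = a b • v)` — `∃ ψ automorphic, P = ofChar ψ μ`;
* `exists_eq_ofChar_of_forall_apply_eq_self_of_commutator_mem (hWA) (P) (N₀) (hN₀) (hcomm)` — the same when a subgroup `N₀` containing every commutator
  `g⁻¹ (1,b)⁻¹ g (1,b)` acts trivially on `P`.

CONTENT.  §1 the CM discharges `…_cm (N L H μ hH hdet …)` (topological instances from ★ `cmDatum L N H`, definitionally the same datum); §2 Mok's
`Φ_N = antidiag(1,…,1)` BINDER-FREE `…_antidiagOne (L N μ …)`.  At `N = 2`, `N₀ :=` the image of `SU(Φ₂)(𝔸_f)` — trivial on `P` after ★ Kneser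
saturation (`AutomorphicQuotientSaturation`) and strong approximation for `SU(Φ₂)` — the commutator form is the O8a endgame «`P = ofChar ψ μ`» of the
cell's census `CENSUS-O8a-PKsaU2` (steps (3)–(6)).

CONSUMER: cell `hodgecm-mathlib`, crux H413 = `stmt-HodgeConjecture-24833`, line LH7, print letters O8a `PKsaU2Shape` ∕ O8b `PKmultOneU2Shape`.  HONEST
LABEL: adelic plumbing over tree theorems, proved; HC_CM is proved only modulo the 7 printed citations of that programme (2 remaining: hLiu418 =
stmt-HodgeConjecture-24832, h413 = stmt-HodgeConjecture-24833) until its rung 0 closes; this file books nothing and discharges nothing booked.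

## References
* [PlatonovRapinchuk1994] V. Platonov, A. Rapinchuk, *Algebraic Groups and Number Theory*, Academic Press (1994), §7.1 Thm. 7.7 p. 415, §7.4.
* [BorelJacquet1979] A. Borel, H. Jacquet, *Automorphic forms and automorphic representations*, Corvallis PSPM 33.1 (1979), §4.6.
* [DeitmarEchterhoff2014] A. Deitmar, S. Echterhoff, *Principles of Harmonic Analysis*, 2nd ed. (2014), Lemma 6.1.7 (Schur).
-/

set_option autoImplicit false

noncomputable section

open MeasureTheory NumberField IsDedekindDomain Topology Filter

open scoped Matrix MatrixGroups Pointwise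

namespace Literature.NumberTheory.Automorphic

namespace UnitaryGroup

/-! ## §1 The CM case -/

section CMExists

variable (N : ℕ) (L : Type) [Field L] [NumberField L] [IsCMField L] (H : Matrix (Fin N) (Fin N) L)
  (μ : Measure (adelicGroupData (↥(maximalRealSubfield L)) L (IsCMField.complexConj L) N H).automorphicQuotient)
  [(adelicGroupData (↥(maximalRealSubfield L)) L (IsCMField.complexConj L) N H).IsAutomorphicMeasure μ]

/-- **A discrete automorphic representation of `U(H)` (CM, `H` non-degenerate hermitian) on which `U(H)(𝔸_{L⁺,f})` acts by scalars `a(g_f)` — ANY scalars —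
is `ofChar ψ μ` for some automorphic character `ψ`**, hypothesis-free (★ `exists_eq_ofChar_of_forall_finAdelicToAdelic_apply_eq_smul` with `hWA`
discharged by `denseRange_archPart_toAdelic_cm`). [cite: PlatonovRapinchuk1994, §7.1 Thm 7.7] [cite: BorelJacquet1979, §4.6] -/
theorem exists_eq_ofChar_of_forall_finAdelicToAdelic_apply_eq_smul_cm (hH : (H.map (IsCMField.complexConj L))ᵀ = H) (hdet : IsUnit H.det)
    (P : DiscreteAutomorphicRep (adelicGroupData (↥(maximalRealSubfield L)) L (IsCMField.complexConj L) N H) μ)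
    {a : finAdelic (↥(maximalRealSubfield L)) L (IsCMField.complexConj L) N H → ℂ}
    (hP : ∀ (b : finAdelic (↥(maximalRealSubfield L)) L (IsCMField.complexConj L) N H) (v : P.space.toSubmodule),
      P.space.toContRep (finAdelicToAdelic (↥(maximalRealSubfield L)) L (IsCMField.complexConj L) N H b) v = a b • v) :
    ∃ ψ : (adelicGroupData (↥(maximalRealSubfield L)) L (IsCMField.complexConj L) N H).AutomorphicCharacter,
      P = DiscreteAutomorphicRep.ofChar ψ μ := by
  haveI : LocallyCompactSpace (adelicGroupData (↥(maximalRealSubfield L)) L (IsCMField.complexConj L) N H).Adelic :=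
    locallyCompactSpace_cmDatum_Adelic L N H
  haveI : SecondCountableTopology (adelicGroupData (↥(maximalRealSubfield L)) L (IsCMField.complexConj L) N H).Adelic :=
    secondCountableTopology_cmDatum_Adelic L N H
  exact exists_eq_ofChar_of_forall_finAdelicToAdelic_apply_eq_smul _ L _ N H μ (denseRange_archPart_toAdelic_cm N L H hH hdet) P hP

/-- **A discrete automorphic representation of `U(H)` (CM, `H` non-degenerate hermitian) on which a subgroup `N₀ ≤ U(H)(𝔸_{L⁺})` containing every commutator
`g⁻¹ (1, b)⁻¹ g (1, b)` acts trivially is `ofChar ψ μ` for some automorphic character `ψ`**, hypothesis-free (★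
`exists_eq_ofChar_of_forall_apply_eq_self_of_commutator_mem` with `hWA` discharged). [cite: PlatonovRapinchuk1994, §7.1 Thm 7.7] [cite: DeitmarEchterhoff2014, Lemma 6.1.7] -/
theorem exists_eq_ofChar_of_forall_apply_eq_self_of_commutator_mem_cm (hH : (H.map (IsCMField.complexConj L))ᵀ = H) (hdet : IsUnit H.det)
    (P : DiscreteAutomorphicRep (adelicGroupData (↥(maximalRealSubfield L)) L (IsCMField.complexConj L) N H) μ)
    (N₀ : Subgroup (adelicGroupData (↥(maximalRealSubfield L)) L (IsCMField.complexConj L) N H).Adelic)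
    (hN₀ : ∀ n ∈ N₀, ∀ v : P.space.toSubmodule, P.space.toContRep n v = v)
    (hcomm : ∀ (b : finAdelic (↥(maximalRealSubfield L)) L (IsCMField.complexConj L) N H)
        (g : (adelicGroupData (↥(maximalRealSubfield L)) L (IsCMField.complexConj L) N H).Adelic),
      g⁻¹ * (finAdelicToAdelic (↥(maximalRealSubfield L)) L (IsCMField.complexConj L) N H b)⁻¹ * g *
        finAdelicToAdelic (↥(maximalRealSubfield L)) L (IsCMField.complexConj L) N H b ∈ N₀) :
    ∃ ψ : (adelicGroupData (↥(maximalRealSubfield L)) L (IsCMField.complexConj L) N H).AutomorphicCharacter,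
      P = DiscreteAutomorphicRep.ofChar ψ μ := by
  haveI : LocallyCompactSpace (adelicGroupData (↥(maximalRealSubfield L)) L (IsCMField.complexConj L) N H).Adelic :=
    locallyCompactSpace_cmDatum_Adelic L N H
  haveI : SecondCountableTopology (adelicGroupData (↥(maximalRealSubfield L)) L (IsCMField.complexConj L) N H).Adelic :=
    secondCountableTopology_cmDatum_Adelic L N H
  exact exists_eq_ofChar_of_forall_apply_eq_self_of_commutator_mem _ L _ N H μ (denseRange_archPart_toAdelic_cm N L H hH hdet) P N₀ hN₀ hcomm

end CMExists

/-! ## §2 Mok's quasi-split form `Φ_N`: binder-free -/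

section AntidiagOneExists

variable (L : Type) [Field L] [NumberField L] [IsCMField L] (N : ℕ)
  (μ : Measure (adelicGroupData (↥(maximalRealSubfield L)) L (IsCMField.complexConj L) N
    (Matrix.of fun i j : Fin N => if i.val + j.val + 1 = N then (1 : L) else 0)).automorphicQuotient)
  [(adelicGroupData (↥(maximalRealSubfield L)) L (IsCMField.complexConj L) N
    (Matrix.of fun i j : Fin N => if i.val + j.val + 1 = N then (1 : L) else 0)).IsAutomorphicMeasure μ]

/-- **`Φ_N`, binder-free: a discrete automorphic representation of `U(Φ_N)` on which `U(Φ_N)(𝔸_{L⁺,f})` acts by scalars `a(g_f)` (any) is `ofChar ψ μ`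
for some automorphic character `ψ`.** [cite: PlatonovRapinchuk1994, §7.1 Thm 7.7] [cite: BorelJacquet1979, §4.6] -/
theorem exists_eq_ofChar_of_forall_finAdelicToAdelic_apply_eq_smul_antidiagOne
    (P : DiscreteAutomorphicRep (adelicGroupData (↥(maximalRealSubfield L)) L (IsCMField.complexConj L) N
      (Matrix.of fun i j : Fin N => if i.val + j.val + 1 = N then (1 : L) else 0)) μ)
    {a : finAdelic (↥(maximalRealSubfield L)) L (IsCMField.complexConj L) N
      (Matrix.of fun i j : Fin N => if i.val + j.val + 1 = N then (1 : L) else 0) → ℂ}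
    (hP : ∀ (b : finAdelic (↥(maximalRealSubfield L)) L (IsCMField.complexConj L) N
        (Matrix.of fun i j : Fin N => if i.val + j.val + 1 = N then (1 : L) else 0)) (v : P.space.toSubmodule),
      P.space.toContRep (finAdelicToAdelic (↥(maximalRealSubfield L)) L (IsCMField.complexConj L) N
          (Matrix.of fun i j : Fin N => if i.val + j.val + 1 = N then (1 : L) else 0) b) v = a b • v) :
    ∃ ψ : (adelicGroupData (↥(maximalRealSubfield L)) L (IsCMField.complexConj L) N
        (Matrix.of fun i j : Fin N => if i.val + j.val + 1 = N then (1 : L) else 0)).AutomorphicCharacter,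
      P = DiscreteAutomorphicRep.ofChar ψ μ :=
  exists_eq_ofChar_of_forall_finAdelicToAdelic_apply_eq_smul_cm N L _ μ (antidiagOne_map_complexConj_transpose L N)
    (isUnit_antidiagOne_det L N) P hP

/-- **`Φ_N`, binder-free: a discrete automorphic representation of `U(Φ_N)` on which a subgroup `N₀` containing every commutator `g⁻¹ (1,b)⁻¹ g (1,b)` acts
trivially is `ofChar ψ μ` for some automorphic character `ψ`** — at `N = 2`, `N₀ :=` the image of `SU(Φ₂)(𝔸_f)` (trivial on `P` after ★ Kneser
saturation `AutomorphicQuotientSaturation` + strong approximation), this is the O8a endgame. [cite: PlatonovRapinchuk1994, §7.4] [cite: DeitmarEchterhoff2014, Lemma 6.1.7] -/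
theorem exists_eq_ofChar_of_forall_apply_eq_self_of_commutator_mem_antidiagOne
    (P : DiscreteAutomorphicRep (adelicGroupData (↥(maximalRealSubfield L)) L (IsCMField.complexConj L) N
      (Matrix.of fun i j : Fin N => if i.val + j.val + 1 = N then (1 : L) else 0)) μ)
    (N₀ : Subgroup (adelicGroupData (↥(maximalRealSubfield L)) L (IsCMField.complexConj L) N
      (Matrix.of fun i j : Fin N => if i.val + j.val + 1 = N then (1 : L) else 0)).Adelic)
    (hN₀ : ∀ n ∈ N₀, ∀ v : P.space.toSubmodule, P.space.toContRep n v = v)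
    (hcomm : ∀ (b : finAdelic (↥(maximalRealSubfield L)) L (IsCMField.complexConj L) N
          (Matrix.of fun i j : Fin N => if i.val + j.val + 1 = N then (1 : L) else 0))
        (g : (adelicGroupData (↥(maximalRealSubfield L)) L (IsCMField.complexConj L) N
          (Matrix.of fun i j : Fin N => if i.val + j.val + 1 = N then (1 : L) else 0)).Adelic),
      g⁻¹ * (finAdelicToAdelic (↥(maximalRealSubfield L)) L (IsCMField.complexConj L) N
          (Matrix.of fun i j : Fin N => if i.val + j.val + 1 = N then (1 : L) else 0) b)⁻¹ * g *
        finAdelicToAdelic (↥(maximalRealSubfield L)) L (IsCMField.complexConj L) N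
          (Matrix.of fun i j : Fin N => if i.val + j.val + 1 = N then (1 : L) else 0) b ∈ N₀) :
    ∃ ψ : (adelicGroupData (↥(maximalRealSubfield L)) L (IsCMField.complexConj L) N
        (Matrix.of fun i j : Fin N => if i.val + j.val + 1 = N then (1 : L) else 0)).AutomorphicCharacter,
      P = DiscreteAutomorphicRep.ofChar ψ μ :=
  exists_eq_ofChar_of_forall_apply_eq_self_of_commutator_mem_cm N L _ μ (antidiagOne_map_complexConj_transpose L N)
    (isUnit_antidiagOne_det L N) P N₀ hN₀ hcomm

end AntidiagOneExists

end UnitaryGroup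

end Literature.NumberTheory.Automorphic

end
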